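import Summits.BirchSwinnertonDyer.BirchSwinnertonDyer.Theorems.GenusKolyvaginAtTwoPowDvdShaCardAtTwoRTAuxiliaryClass
import Literature.NumberTheory.EllipticCurves.McCallumAuxiliaryClass
import Literature.NumberTheory.EllipticCurves.ArchimedeanKummerImageMaximal
import HarnessLib

/-!
# Route `GenusKolyvaginAtTwo`, LINES 18/19 (L_T stmt-BirchSwinnertonDyer-23242, L⁺_T stmt-23379), step (b) input I5, part 4:
# McCALLUM 1991 PROP. 2.1 IN THE SHAPE OF THE NAMED FACT `McCallum1991_prop_2_1_auxiliaryClass` — the prime-power levels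
# over a TOTALLY COMPLEX number field are a THEOREM (all places of `K`, finite and infinite, in `w`, `S`, `H`)

Width seat `bsd-line-gk2-p4` g16 (cell `bsd-f1-sign2`), `--supports stmt-BirchSwinnertonDyer-23242` (helper; closes nothing).
THEOREMS ONLY: no definition, no named fact, no `sorry`; standard axioms.  BSD is NOT proved by any of this.
Sequel of `…RTAuxiliaryClass.lean` (p687988: McCallum Prop. 2.1 unconditional for finite places of a totally complex `K`).

WHY.  gk2-p2 g15 typed input I5 of the 3a⁗ swap oracle as the Literature named fact
`Literature.NumberTheory.EllipticCurves.McCallum1991_prop_2_1_auxiliaryClass K` (p687525, `Literature/…/McCallumAuxiliaryClass.lean`):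
for EVERY number field `K`, every `E/K`, EVERY `m > 1`, any place `w` (finite or infinite) with `H¹(K_w, E_m) ≠ 0`, any finite
set `S ∌ w` of places and half-length `H_v` (`v ∈ S`), a class `c ≠ 0` with `loc_v c ∈ δ(E(K_v))` for `v ∉ S ∪ {w}` and
`loc_v c ∈ H_v` on `S`.  This file proves that statement VERBATIM IN SHAPE on the sub-case every consumer in the tree uses —
`m = p^k` a prime power (`k ≥ 1`, `p = 2` included) and `K` totally complex (Kolyvagin's / McCallum's `K` is imaginary
quadratic) — from part 2's finite-place theorem: at a complex place `H¹(K_w, E[m]) = 0`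
(`galoisCohomology_one_torsion_eq_zero_infinitePlace_of_isComplex`), so an infinite `w` is excluded by its own hypothesis, the
infinite members of `S` impose nothing, and the Kummer condition at the infinite places off `S ∪ {w}` is part of `kummerOutside`.

WHAT (namespace `…Theorems.GenusExact.AuxiliaryClass`).
* `mcCallum_prop_2_1_primePow` — the body of `McCallum1991_prop_2_1_auxiliaryClass K` with `m := p^k`, for `K` with all
  infinite places complex, UNCONDITIONAL (binders in the fact's order: `W`, level, `w`, non-vanishing at `w`, `S`, `w ∉ S`, `H`,
  half-length on `S`; conclusion `∃ c ≠ 0, (∀ v ∉ S, v ≠ w → loc_v c ∈ 𝓛_v) ∧ (∀ v ∈ S, loc_v c ∈ H_v)`).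
* `mcCallum1991_prop_2_1_auxiliaryClass_primePow_of_isComplex` — the same packaged as
  `∀ W p k, p.Prime → 0 < k → <body of the fact at m = p^k>`, i.e. the fact's restriction to prime-power levels, for use BY NAME
  next to `(h : McCallum1991_prop_2_1_auxiliaryClass K)` binders.

WHAT IS NOT PROVED: the fact itself (`∀ m > 1`, every `K`).  Composite `m`: the maximal-isotropic count is multiplicative over
the primary parts, but the tree's Poitou–Tate exactness for the Kummer structure (X11b `exists_mem_kummerOutside_localization_eq`)
is typed at prime-power level; real places: that exactness theorem assumes `K` totally complex.  Both are bookkeeping over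
Milne I 4.10(b) (a tree theorem: `poitouTate_selmerStructure_duality_holds`), not used by any consumer of LINES 6/13/18/19
(levels `2^M`, `K` imaginary quadratic).  BSD is NOT proved by any of this.

References: [McCallumLMS1991] §2 Prop. 2.1 (p. 300); [MilneADT2006] Ch. I Thm. 2.8, Thm. 4.10(b); [SerreGaloisCohomology1997] II §6.
-/

set_option autoImplicit false
-- the Theorems namespace of this sub repeats the summit name by design (D-0017 nested layout)
set_option linter.dupNamespace false

noncomputable section

open scoped Classical

open CategoryTheory Field NumberField IsDedekindDomain Function
open Literature.NumberTheory.EllipticCurves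
open Literature.NumberTheory.GaloisRepresentations
open Literature.NumberTheory.GaloisCohomology
open Summit.BirchSwinnertonDyer.Rank1Residual.X11b.KummerPT
open scoped ContRepresentation

namespace Summit.BirchSwinnertonDyer.BirchSwinnertonDyer.Theorems.GenusExact.AuxiliaryClass

variable {K : Type} [Field K] [NumberField K]

/-- **McCallum 1991, Prop. 2.1 at prime-power level over a totally complex number field — the body of the named fact
`McCallum1991_prop_2_1_auxiliaryClass K` at `m = p^k`, PROVED** (all places allowed in `w`, `S`, `H`): for `E = W` elliptic over
`K` (all infinite places complex), `k ≥ 1`, a place `w` with `H¹(K_w, E[p^k]) ≠ 0`, a finite set `S ∌ w` of places and subgroups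
`H_v ≤ H¹(K_v, E[p^k])` with `#H_v · #H_v = #H¹(K_v, E[p^k])` (`v ∈ S`), there is `c ∈ H¹(K, E[p^k])`, `c ≠ 0`, with
`loc_v c ∈ δ(E(K_v))` (`= W.kummerSelmerStructure (p^k) v`) for every place `v ∉ S`, `v ≠ w`, and `loc_v c ∈ H_v` for `v ∈ S`.
Proof: `w` is finite (at a complex place `H¹ = 0`); apply part 2's `exists_ne_zero_selmerLocalKer`-road
(`exists_ne_zero_mem_kummerOutside_of_facts` with the tree theorems `poitouTate_selmerStructure_duality_holds`,
`localEulerPoincareCharacteristic_holds`) to the finite part of `S`; infinite members of `S` impose nothing.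
[cite: McCallumLMS1991, §2 Prop. 2.1] [cite: MilneADT2006, Ch. I, Thm. 2.8 and Thm. 4.10(b)] -/
theorem mcCallum_prop_2_1_primePow (hK : ∀ w : InfinitePlace K, w.IsComplex) (W : WeierstrassCurve K) [W.IsElliptic]
    (p k : ℕ) [Fact p.Prime] (hk : 0 < k) (w : Place K)
    (hw : ∃ x : galoisCohomology ((W.torsionGaloisModule ((p ^ k : ℕ) : ℤ)).toLocal w) 1, x ≠ 0)
    (S : Finset (Place K)) (hwS : w ∉ S)
    (H : ∀ v : Place K, AddSubgroup (galoisCohomology ((W.torsionGaloisModule ((p ^ k : ℕ) : ℤ)).toLocal v) 1))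
    (hH : ∀ v ∈ S, Nat.card (H v) * Nat.card (H v) =
      Nat.card (galoisCohomology ((W.torsionGaloisModule ((p ^ k : ℕ) : ℤ)).toLocal v) 1)) :
    ∃ c : galoisCohomology (W.torsionGaloisModule ((p ^ k : ℕ) : ℤ)) 1, c ≠ 0 ∧
      (∀ v : Place K, v ∉ S → v ≠ w →
        galoisCohomology.localization (W.torsionGaloisModule ((p ^ k : ℕ) : ℤ)) v 1 c ∈
          W.kummerSelmerStructure ((p ^ k : ℕ) : ℤ) v) ∧
      (∀ v ∈ S, galoisCohomology.localization (W.torsionGaloisModule ((p ^ k : ℕ) : ℤ)) v 1 c ∈ H v) := by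
  classical
  -- vanishing at the (complex) infinite places
  have hinf : ∀ (w' : InfinitePlace K)
      (x : galoisCohomology ((W.torsionGaloisModule ((p ^ k : ℕ) : ℤ)).toLocal (Sum.inl w')) 1), x = 0 :=
    fun w' x ↦ W.galoisCohomology_one_torsion_eq_zero_infinitePlace_of_isComplex w' (hK w') x
  -- `w` is a finite place
  obtain ⟨w₀, rfl⟩ : ∃ w₀ : HeightOneSpectrum (𝓞 K), w = Sum.inr w₀ := by
    rcases w with w' | w₀
    · obtain ⟨x, hx⟩ := hw
      exact absurd (hinf w' x) hx
    · exact ⟨w₀, rfl⟩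
  -- the finite part of `S`
  have hw₀S : w₀ ∉ S.toRight := fun h ↦ hwS (Finset.mem_toRight.mp h)
  haveI := finite_galoisCohomology_toLocal_inr W (p ^ k) w₀
  have hw' : 1 < Nat.card (galoisCohomology ((W.torsionGaloisModule ((p ^ k : ℕ) : ℤ)).toLocal (Sum.inr w₀)) 1) := by
    obtain ⟨x, hx⟩ := hw
    exact Finite.one_lt_card_iff_nontrivial.mpr ⟨⟨x, 0, hx⟩⟩
  have hH' : ∀ v ∈ S.toRight, Nat.card (H (Sum.inr v)) ^ 2 =
      Nat.card (galoisCohomology ((W.torsionGaloisModule ((p ^ k : ℕ) : ℤ)).toLocal (Sum.inr v)) 1) := by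
    intro v hv
    rw [sq]
    exact hH (Sum.inr v) (Finset.mem_toRight.mp hv)
  obtain ⟨c, hc, hc0, hcH⟩ := exists_ne_zero_mem_kummerOutside_of_facts W p k hK hk
    (Summit.BirchSwinnertonDyer.BirchSwinnertonDyer.Theorems.SchneiderFreeAdditiveX3.PoitouTateReduction.poitouTate_selmerStructure_duality_holds
      K)
    (fun v ↦ by
      haveI : CharZero (v.adicCompletion K) := charZero_adicCompletion v
      exact localEulerPoincareCharacteristic_holds (v.adicCompletion K))
    S.toRight w₀ hw₀S hw' (fun v ↦ H (Sum.inr v)) hH'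
  have hc' := (mem_kummerOutside_iff W (p ^ k) _ c).mp hc
  refine ⟨c, hc0, fun v hvS hvw ↦ ?_, fun v hv ↦ ?_⟩
  · -- the Kummer condition off `S ∪ {w}`: `v ∉ (insert w₀ S.toRight).map inr`
    refine hc' v fun h ↦ ?_
    rw [Finset.mem_map] at h
    obtain ⟨u, hu, rfl⟩ := h
    rcases Finset.mem_insert.mp hu with h | h
    · exact hvw (by rw [h]; rfl)
    · exact hvS (Finset.mem_toRight.mp h)
  · -- the prescribed condition on `S`
    rcases v with w' | u
    · rw [hinf w' (galoisCohomology.localization (W.torsionGaloisModule ((p ^ k : ℕ) : ℤ)) (Sum.inl w') 1 c)]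
      exact zero_mem _
    · exact hcH u (Finset.mem_toRight.mpr hv)

/-- **The prime-power levels of the named fact `McCallum1991_prop_2_1_auxiliaryClass K` are a THEOREM for every totally
complex number field `K`**: the fact's body (`Literature/NumberTheory/EllipticCurves/McCallumAuxiliaryClass.lean`, p687525) with
its level binder `m, 1 < m` specialised to `m = p^k`, `p` prime, `k ≥ 1`, in the fact's binder order — for consumers holding
`(h : McCallum1991_prop_2_1_auxiliaryClass K)` at level `2^M` over an imaginary quadratic `K`, this term replaces `h`.
(What remains of the fact beyond this theorem: composite levels `m`, and number fields with a real place.)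
[cite: McCallumLMS1991, §2 Prop. 2.1] -/
theorem mcCallum1991_prop_2_1_auxiliaryClass_primePow_of_isComplex (hK : ∀ w : InfinitePlace K, w.IsComplex) :
    ∀ (W : WeierstrassCurve K) [W.IsElliptic] (p k : ℕ), p.Prime → 0 < k →
    ∀ (w : Place K), (∃ x : galoisCohomology ((W.torsionGaloisModule ((p ^ k : ℕ) : ℤ)).toLocal w) 1, x ≠ 0) →
    ∀ (S : Finset (Place K)), w ∉ S →
    ∀ (H : ∀ v : Place K, AddSubgroup (galoisCohomology ((W.torsionGaloisModule ((p ^ k : ℕ) : ℤ)).toLocal v) 1)),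
      (∀ v ∈ S, Nat.card (H v) * Nat.card (H v) =
        Nat.card (galoisCohomology ((W.torsionGaloisModule ((p ^ k : ℕ) : ℤ)).toLocal v) 1)) →
      ∃ c : galoisCohomology (W.torsionGaloisModule ((p ^ k : ℕ) : ℤ)) 1, c ≠ 0 ∧
        (∀ v : Place K, v ∉ S → v ≠ w →
          galoisCohomology.localization (W.torsionGaloisModule ((p ^ k : ℕ) : ℤ)) v 1 c ∈
            W.kummerSelmerStructure ((p ^ k : ℕ) : ℤ) v) ∧
        (∀ v ∈ S, galoisCohomology.localization (W.torsionGaloisModule ((p ^ k : ℕ) : ℤ)) v 1 c ∈ H v) := by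
  intro W _ p k hp hk w hw S hwS H hH
  haveI : Fact p.Prime := ⟨hp⟩
  exact mcCallum_prop_2_1_primePow hK W p k hk w hw S hwS H hH

/-- **Sanity link with the named fact**: the fact `McCallum1991_prop_2_1_auxiliaryClass K` (all `m > 1`) implies the
prime-power statement proved above — i.e. the theorem is literally a specialisation of the fact's body (no re-typing drift).
[cite: McCallumLMS1991, §2 Prop. 2.1] -/
theorem mcCallum_prop_2_1_primePow_of_fact (h : McCallum1991_prop_2_1_auxiliaryClass K) (W : WeierstrassCurve K)
    [W.IsElliptic] (p k : ℕ) [Fact p.Prime] (hk : 0 < k) (w : Place K)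
    (hw : ∃ x : galoisCohomology ((W.torsionGaloisModule ((p ^ k : ℕ) : ℤ)).toLocal w) 1, x ≠ 0)
    (S : Finset (Place K)) (hwS : w ∉ S)
    (H : ∀ v : Place K, AddSubgroup (galoisCohomology ((W.torsionGaloisModule ((p ^ k : ℕ) : ℤ)).toLocal v) 1))
    (hH : ∀ v ∈ S, Nat.card (H v) * Nat.card (H v) =
      Nat.card (galoisCohomology ((W.torsionGaloisModule ((p ^ k : ℕ) : ℤ)).toLocal v) 1)) :
    ∃ c : galoisCohomology (W.torsionGaloisModule ((p ^ k : ℕ) : ℤ)) 1, c ≠ 0 ∧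
      (∀ v : Place K, v ∉ S → v ≠ w →
        galoisCohomology.localization (W.torsionGaloisModule ((p ^ k : ℕ) : ℤ)) v 1 c ∈
          W.kummerSelmerStructure ((p ^ k : ℕ) : ℤ) v) ∧
      (∀ v ∈ S, galoisCohomology.localization (W.torsionGaloisModule ((p ^ k : ℕ) : ℤ)) v 1 c ∈ H v) := by
  have hprime : p.Prime := Fact.out
  exact h W (p ^ k) (lt_of_lt_of_le hprime.one_lt (Nat.le_self_pow hk.ne' p)) w hw S hwS H hH

end Summit.BirchSwinnertonDyer.BirchSwinnertonDyer.Theorems.GenusExact.AuxiliaryClass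

end
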